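import Summits.AtomisticToContinuum.FouriersLaw.Theorems.EmbeddedDrudeMourreGreenKuboContinuationGibbsFamily
import Summits.AtomisticToContinuum.FouriersLaw.Theorems.EmbeddedDrudeMourreGreenKuboContinuationBmFlowInvariant
import Summits.AtomisticToContinuum.FouriersLaw.Theorems.EmbeddedDrudeMourreGreenKuboContinuationRegularDLRUnique
import Summits.AtomisticToContinuum.FouriersLaw.Theorems.EmbeddedDrudeMourreGreenKuboContinuationCurrentVariancePos
import Summits.AtomisticToContinuum.FouriersLaw.Theorems.EmbeddedDrudeMourreGreenKuboContinuationRegularTransport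
import Summits.AtomisticToContinuum.FouriersLaw.Theorems.EmbeddedDrudeMourreGreenKuboContinuationRegularMixing

/-!
# The regular thermal family of the pinned anharmonic chain — `thermalFamily`
(crux `EmbeddedDrudeMourre.GreenKuboContinuation`, item stmt-AtomisticToContinuum-12597, line
`temperature-blind-vitali-hurwitz`; `--supports` packaging file of the continuation lead c2)

This file assembles, ONCE AND IMPORTABLY, the object every checked line of the crux (and the sibling
items `FourierGreenKubo.InfiniteVolumeSetup` stmt-0743, `CurrentTiltQuench.SymmetricSetup` stmt-11036, the sibling
crux `AbelThermodynamicLimit` stmt-12596) works with: the REGULAR THERMAL FAMILY of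
`P = pinnedChain ω₂ lam β γ` (all four parameters `> 0`) — ONE infinite-volume dynamics `D` (the
Buttà–Marchioro flow, carrier `bmGood P`) and a family `T ↦ μ T` of states such that for every `T > 0`

* `μ T` is a DLR Gibbs state at `T`, shift-invariant, Buttà–Marchioro superstable (2.3);
* `D` preserves `μ T`;
* the space-summed current autocorrelation `C_T(t) = Σ_x ∫ j₀ · (j_x ∘ φ_t) dμ_T` converges absolutely at every `t`;
* the ABEL FUNCTIONAL `A_T(ν) = ∫₀^∞ e^{-νt} C_T(t) dt` is `> 0` for every `ν > 0`.

This is verbatim the statement of the (rev 1–4) registered stub `stub_thermalFamily` of the line, which the leads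
split by nature (revs 5, 7) into the stubs 1a `stub_gibbsFamily` (existence: transfer-operator Markov state,
p95807 ← Literature p94153), 1b `stub_bmFlowInvariant` (the frozen flow preserves every superstable DLR state,
p85707 ← p83640), 2 `stub_regularDLRUnique` (uniqueness among shift-invariant DLR states, p104419 ← p102497),
1c-M `stub_regularMixing` (exponential ρ-mixing from the Jentzsch gap, p105722), 1c-G3 `stub_currentVariancePos`
(`0 < C_T(0)`, p102797) and 1c `stub_regularTransport` (BM fixed-time `L²` locality + clustering ⇒ absolute
convergence; Bochner positivity ⇒ `A_T(ν) > 0`, p104231) — all ACCEPTED. Here they are glued (the sorry-free glue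
`thermalFamily_of_parts ∘ regularTransport_of_parts` of the skeleton, which lives in a non-importable `Lines/`
file) into the single theorem `thermalFamily`, plus the two corollaries a consumer actually quotes:
`thermalFamily_state_unique` (any shift-invariant DLR state at `T` IS `μ T`) and `regularTransport_of_shiftInvariant`
(for the family's flow, EVERY shift-invariant DLR state at `T` is preserved, has absolutely convergent correlations and a
positive Abel functional — superstability being automatic, `hasSuperstabilityEstimate_of_isShiftInvariant_pinnedChain`).
No new mathematics; packaging only.
-/

noncomputable section

namespace Summit.AtomisticToContinuum.FouriersLaw.Theorems.GreenKuboContinuation.TemperatureBlindVitaliHurwitz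

open Filter Topology MeasureTheory Set
open Literature.MathematicalPhysics.KineticTheory.HeatConduction

/-- **Transport regularity of every shift-invariant DLR state under a flow with carrier `bmGood`.** For
`P = pinnedChain ω₂ lam β γ` (all `> 0`), a dynamics `D` with `D.carrier = P.bmGood`, `T > 0` and a shift-invariant DLR
state `μ` at `T` that `D` preserves: the summed current autocorrelation converges absolutely at every time and the Abel
functional is positive for every `ν > 0`. (Stubs 2, 1c-M, 1c-G3, 1c of the line, composed; superstability of `μ` from shift
invariance.) [cite: ButtaMarchioro2016, Thm 2.2; CassandroOlivieriPellegrinottiPresutti1978, §3] -/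
theorem regularTransport_of_shiftInvariant {ω₂ lam β γ : ℝ} (hω : 0 < ω₂) (hl : 0 < lam) (hβ : 0 < β)
    (hγ : 0 < γ) (D : InfiniteChainDynamics (pinnedChain ω₂ lam β γ))
    (hcar : D.carrier = (pinnedChain ω₂ lam β γ).bmGood) {T : ℝ} (hT : 0 < T) {μ : Measure ChainConfig}
    (hG : (pinnedChain ω₂ lam β γ).IsChainGibbsMeasure T μ) (hS : IsShiftInvariant μ)
    (hP : D.PreservesMeasure μ) :
    (∀ t : ℝ, D.HasAbsConvergentCorrelation μ t) ∧
      ∀ ν : ℝ, 0 < ν → 0 < ∫ t in Ioi (0:ℝ), Real.exp (-(ν * t)) * D.currentCorrelation μ t := by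
  have hSS : (pinnedChain ω₂ lam β γ).HasSuperstabilityEstimate μ :=
    OscillatorChain.hasSuperstabilityEstimate_of_isShiftInvariant_pinnedChain γ hω hl.le hβ.le hT hG hS
  have hU := stub_regularDLRUnique ω₂ lam β γ hω hl hβ hγ T hT
  exact stub_regularTransport ω₂ lam β γ hω hl hβ hγ D hcar T hT hU
    (stub_regularMixing ω₂ lam β γ hω hl hβ hγ T hT hU)
    (stub_currentVariancePos ω₂ lam β γ hω hl hβ hγ D hcar T hT) μ hG hS hSS hP

/-- **The regular thermal family exists** (statement of the rev 1–4 registered stub `stub_thermalFamily` of line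
`temperature-blind-vitali-hurwitz`, verbatim): for `P = pinnedChain ω₂ lam β γ` (all `> 0`) there are `μ : ℝ → Measure ChainConfig`
and ONE dynamics `D` with `D.carrier = P.bmGood` such that for every `T > 0`, `μ T` is a shift-invariant, BM-superstable DLR Gibbs
state at `T`, preserved by `D`, with absolutely convergent summed current autocorrelation at every time and a positive Abel
functional `∫₀^∞ e^{-νt} C_T(t) dt` for every `ν > 0`. (Glue of stubs 1a, 1b, 2, 1c-M, 1c-G3, 1c — all landed.)
[cite: ButtaMarchioro2016, Thm 2.1 and (2.6); CassandroOlivieriPellegrinottiPresutti1978, §2–3] -/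
theorem thermalFamily :
    ∀ ω₂ lam β γ : ℝ, 0 < ω₂ → 0 < lam → 0 < β → 0 < γ →
      ∃ (μ : ℝ → MeasureTheory.Measure
            Literature.MathematicalPhysics.KineticTheory.HeatConduction.ChainConfig)
        (D : Literature.MathematicalPhysics.KineticTheory.HeatConduction.InfiniteChainDynamics
          (Literature.MathematicalPhysics.KineticTheory.HeatConduction.pinnedChain ω₂ lam β γ)),
        D.carrier =
            (Literature.MathematicalPhysics.KineticTheory.HeatConduction.pinnedChain
              ω₂ lam β γ).bmGood ∧
          ∀ T : ℝ, 0 < T →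
            (Literature.MathematicalPhysics.KineticTheory.HeatConduction.pinnedChain
                ω₂ lam β γ).IsChainGibbsMeasure T (μ T) ∧
            Literature.MathematicalPhysics.KineticTheory.HeatConduction.IsShiftInvariant (μ T) ∧
            (Literature.MathematicalPhysics.KineticTheory.HeatConduction.pinnedChain
                ω₂ lam β γ).HasSuperstabilityEstimate (μ T) ∧
            D.PreservesMeasure (μ T) ∧
            (∀ t : ℝ, D.HasAbsConvergentCorrelation (μ T) t) ∧
            (∀ ν : ℝ, 0 < ν →
              0 < MeasureTheory.integral (MeasureTheory.volume.restrict (Set.Ioi (0:ℝ)))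
                (fun t : ℝ => Real.exp (-(ν * t)) * D.currentCorrelation (μ T) t)) := by
  intro ω₂ lam β γ hω hl hβ hγ
  obtain ⟨μ, hμ⟩ := stub_gibbsFamily ω₂ lam β γ hω hl hβ hγ
  obtain ⟨D, hcar, hpres⟩ := stub_bmFlowInvariant ω₂ lam β γ hω hl hβ hγ
  refine ⟨μ, D, hcar, fun T hT => ?_⟩
  obtain ⟨hG, hS, hSS⟩ := hμ T hT
  have hP : D.PreservesMeasure (μ T) := hpres T hT (μ T) hG hSS
  obtain ⟨hAC, hpos⟩ := regularTransport_of_shiftInvariant hω hl hβ hγ D hcar hT hG hS hP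
  exact ⟨hG, hS, hSS, hP, hAC, hpos⟩

/-- **The state of the thermal family is THE shift-invariant DLR state**: for `P = pinnedChain ω₂ lam β γ` (all `> 0`) and
`T > 0`, any two shift-invariant DLR Gibbs states at `T` coincide (restatement of Stub 2 without the idle superstability
hypotheses, for consumers of `thermalFamily`). [cite: CassandroOlivieriPellegrinottiPresutti1978, §3] -/
theorem thermalFamily_state_unique {ω₂ lam β γ : ℝ} (hω : 0 < ω₂) (hl : 0 < lam) (hβ : 0 < β) (hγ : 0 < γ)
    {T : ℝ} (hT : 0 < T) {μ₁ μ₂ : Measure ChainConfig}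
    (h₁ : (pinnedChain ω₂ lam β γ).IsChainGibbsMeasure T μ₁) (hS₁ : IsShiftInvariant μ₁)
    (h₂ : (pinnedChain ω₂ lam β γ).IsChainGibbsMeasure T μ₂) (hS₂ : IsShiftInvariant μ₂) : μ₁ = μ₂ :=
  stub_regularDLRUnique ω₂ lam β γ hω hl hβ hγ T hT μ₁ μ₂ h₁ hS₁
    (OscillatorChain.hasSuperstabilityEstimate_of_isShiftInvariant_pinnedChain γ hω hl.le hβ.le hT h₁ hS₁) h₂ hS₂
    (OscillatorChain.hasSuperstabilityEstimate_of_isShiftInvariant_pinnedChain γ hω hl.le hβ.le hT h₂ hS₂)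

end Summit.AtomisticToContinuum.FouriersLaw.Theorems.GreenKuboContinuation.TemperatureBlindVitaliHurwitz

end
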